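import Mathlib
import HarnessLib
import Literature.Analysis.FluidPDE.SelfSimilar
import Literature.Analysis.FluidPDE.VectorCalculus
import Literature.Analysis.FluidPDE.WholeSpaceIBP
import Literature.Analysis.FluidPDE.SverakLandauConformalCalc
import Literature.Analysis.FluidPDE.ClassicalSolution
import Literature.Analysis.FluidPDE.NSBoundedMildOseenClassical
import Summits.NavierStokesRegularity.NavierStokesRegularity.Theorems.UnthreadedDoorAntidynamoRadialGradientUnthreaded

/-!
# Route `UnthreadedDoor` / `ThreadingFlux`, crux `PoloidalLiouville` (stmt-NavierStokesRegularity-1222), antidynamo v2 skeleton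
# (sha16 `4ebf5683127b`), rung `stub_singleDegreeRung` (BC5): the RADIAL BRANCH — a radial, divergence-free `C¹` field on `ℝ³` vanishes

Support file (seat leafhand-ns-unthreadeddoor-1 g0, cell decomp-ns), `--supports stmt-NavierStokesRegularity-1222 --as helper`; theorems only.

In the junk-robust analysis of the rung (`UnthreadedDoorAntidynamoRadialGradientUnthreaded.lean`, p794367) the slice `v(t)` is
`gradient φ + h • (x − x₀)` pointwise with ARBITRARY `φ`, `h`; when the differentiability set of `φ` has EMPTY INTERIOR the field is
radial everywhere (`v(t) x × (x − x₀) = 0` on the closure of the non-differentiability set, which is then all of `ℝ³`).  This file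
settles that branch (step S2(a) of the hand's census): a `C¹` divergence-free field that is everywhere parallel to `x − x₀` is
identically zero, so such slices are constant (indeed zero).

* ★ `eq_zero_of_cross_self_eq_zero_of_isDivFree` — `v ∈ C¹(ℝ³;ℝ³)`, `v z × z = 0` for all `z`, `div v ≡ 0` ⇒ `v ≡ 0`.  Proof: off the
  origin `v = k • id` with `k = ⟪z, v z⟫/‖z‖²`; `div v = 3k + ⟪z, ∇k⟫ = 0`; along each ray the function `h(s) = s² ⟪z, v(s z)⟫` has
  `h′(s) = 2s⟪z, v(sz)⟫ + s²⟪z, Dv(sz) z⟫ = 0`, hence is constant on `(0,∞)`, and `h(s) → 0` as `s → 0⁺`; so `⟪z, v z⟫ = h(1) = 0` and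
  `v z = 0`; at the origin by continuity.
* ★ `eq_zero_of_cross_sub_eq_zero_of_isDivFree` — the same about any centre `x₀`.
* ★ `singleDegreeRung_of_radial` — rung hypotheses + the branch condition `∀ t<0, ∀ x, v t x × (x − x₀) = 0` ⇒ constant slices
  (divergence-freeness from the duality class: weakly div-free + `C¹`, tree `IsWeaklyDivFree.isDivFree_of_contDiff`).

HONEST LABEL: one branch of a plan-only stub; nothing here proves the rung, the wall `stub_scalarLiouville`, `PoloidalLiouville` (1222) or
bears on NS regularity.  [folklore]
-/

noncomputable section

-- the summit and its single sub-problem share the name (CONVENTIONS §1)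
set_option linter.dupNamespace false

open scoped Topology InnerProductSpace RealInnerProductSpace ContDiff
open Filter Set Function Metric MeasureTheory
open Literature.Analysis.FluidPDE

namespace Summit.NavierStokesRegularity.NavierStokesRegularity.Theorems.PoloidalLiouville.Antidynamo

/-- RAY LEMMA.  For `v ∈ C¹` radial (`v z × z = 0`) and divergence free, `⟪z, v z⟫ = 0` for every `z`: along the ray through
`z ≠ 0` the function `h(s) = s² ⟪z, v(s z)⟫` has zero derivative on `(0,∞)` (from `div v = 3k + ⟪z,∇k⟫ = 0` for `v = k • id`) and
tends to `0` as `s → 0⁺`. [folklore] -/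
theorem inner_self_eq_zero_of_cross_self_eq_zero_of_isDivFree
    {v : EuclideanSpace ℝ (Fin 3) → EuclideanSpace ℝ (Fin 3)}
    (hv : ContDiff ℝ 1 v) (hrad : ∀ z, cross (v z) z = 0) (hdiv : VectorCalculus.IsDivFree v)
    (z : EuclideanSpace ℝ (Fin 3)) : ⟪z, v z⟫ = 0 := by
  by_cases hz : z = 0
  · rw [hz, inner_zero_left]
  have hvd : ∀ w, DifferentiableAt ℝ v w := fun w => hv.differentiable one_ne_zero w
  -- the radial coefficient `k = ⟪z, v z⟫ / ‖z‖²`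
  set k : EuclideanSpace ℝ (Fin 3) → ℝ := fun w => ⟪w, v w⟫ / ‖w‖ ^ 2 with hk
  have hvk : ∀ w, w ≠ 0 → v w = k w • w := fun w hw => eq_smul_of_cross_eq_zero hw (hrad w)
  have hkd : ∀ w : EuclideanSpace ℝ (Fin 3), w ≠ 0 → DifferentiableAt ℝ k w := by
    intro w hw
    have hid : DifferentiableAt ℝ (fun y : EuclideanSpace ℝ (Fin 3) => y) w := differentiableAt_id
    have hnum : DifferentiableAt ℝ (fun y : EuclideanSpace ℝ (Fin 3) => ⟪y, v y⟫) w := hid.inner ℝ (hvd w)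
    have hden : DifferentiableAt ℝ (fun y : EuclideanSpace ℝ (Fin 3) => ‖y‖ ^ 2) w := hid.norm_sq ℝ
    have hk' : k = fun y => ⟪y, v y⟫ * (‖y‖ ^ 2)⁻¹ := by
      funext y; simp only [hk, div_eq_mul_inv]
    rw [hk']
    exact hnum.mul (hden.inv (pow_ne_zero _ (norm_ne_zero_iff.2 hw)))
  -- derivative of `v = k • id` off the origin, and the divergence constraint `3 k + Dk(w) w = 0`
  have hfd : ∀ w : EuclideanSpace ℝ (Fin 3), w ≠ 0 →
      fderiv ℝ v w = k w • ContinuousLinearMap.id ℝ (EuclideanSpace ℝ (Fin 3)) + (fderiv ℝ k w).smulRight w := by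
    intro w hw
    have hev : v =ᶠ[𝓝 w] fun y => k y • y := by
      filter_upwards [compl_singleton_mem_nhds hw] with y hy using hvk y hy
    rw [hev.fderiv_eq]
    exact ((hkd w hw).hasFDerivAt.smul (hasFDerivAt_id w)).fderiv
  have hdivk : ∀ w : EuclideanSpace ℝ (Fin 3), w ≠ 0 → 3 * k w + fderiv ℝ k w w = 0 := by
    intro w hw
    have hev : v =ᶠ[𝓝 w] fun y => k y • y := by
      filter_upwards [compl_singleton_mem_nhds hw] with y hy using hvk y hy
    have h1 : VectorCalculus.divergence v w = VectorCalculus.divergence (fun y => k y • y) w := by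
      simp only [VectorCalculus.divergence, hev.fderiv_eq]
    have h2 := divergence_smul_apply (u := fun y : EuclideanSpace ℝ (Fin 3) => y) (hkd w hw) differentiableAt_id
    rw [Sverak2011.divergence_id_three, real_inner_comm, gradient, InnerProductSpace.toDual_symm_apply] at h2
    have h0 : VectorCalculus.divergence v w = 0 := hdiv w
    rw [h1, h2] at h0
    linarith
  -- the ray function `h(s) = s² ⟪z, v (s • z)⟫`
  set h : ℝ → ℝ := fun s => s ^ 2 * ⟪z, v (s • z)⟫ with hh
  have hderiv : ∀ s : ℝ, 0 < s → HasDerivAt h 0 s := by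
    intro s hs
    have hsz : s • z ≠ 0 := smul_ne_zero hs.ne' hz
    -- `d/ds v(s z) = Dv(s z) z`
    have hray : HasDerivAt (fun s : ℝ => v (s • z)) (fderiv ℝ v (s • z) z) s := by
      have h1 : HasDerivAt (fun s : ℝ => s • z) z s := by
        simpa using (hasDerivAt_id s).smul_const z
      exact (hvd (s • z)).hasFDerivAt.comp_hasDerivAt s h1
    have hinner : HasDerivAt (fun s : ℝ => ⟪z, v (s • z)⟫) ⟪z, fderiv ℝ v (s • z) z⟫ s := by
      have := (hasDerivAt_const s z).inner ℝ hray
      simpa using this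
    have hprod := ((hasDerivAt_pow 2 s)).mul hinner
    -- evaluate the derivative: `2 s ⟪z, v(sz)⟫ + s² ⟪z, Dv(sz) z⟫ = 0`
    have hval : (↑2 * s ^ (2 - 1)) * ⟪z, v (s • z)⟫ + s ^ 2 * ⟪z, fderiv ℝ v (s • z) z⟫ = 0 := by
      have hkz : fderiv ℝ k (s • z) (s • z) = s * fderiv ℝ k (s • z) z := by
        rw [map_smul, smul_eq_mul]
      have hc := hdivk (s • z) hsz
      rw [hkz] at hc
      rw [hfd (s • z) hsz, hvk (s • z) hsz]
      simp only [_root_.add_apply, _root_.smul_apply, ContinuousLinearMap.coe_id', id_eq,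
        ContinuousLinearMap.smulRight_apply, inner_add_right, real_inner_smul_right, real_inner_self_eq_norm_sq]
      have : fderiv ℝ k (s • z) z * s = -3 * k (s • z) := by linarith
      push_cast
      linear_combination (s ^ 2 * ‖z‖ ^ 2) * this
    exact hval ▸ hprod
  -- `h` is constant on `(0, ∞)`
  have hconst : ∀ s : ℝ, 0 < s → h s = h 1 := by
    intro s hs
    have hdiff : DifferentiableOn ℝ h (Ioi 0) := fun x hx => (hderiv x hx).differentiableAt.differentiableWithinAt
    refine (convex_Ioi (0 : ℝ)).is_const_of_fderivWithin_eq_zero hdiff (fun x hx => ?_) (mem_Ioi.2 hs)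
      (mem_Ioi.2 one_pos)
    rw [fderivWithin_of_isOpen isOpen_Ioi hx, (hderiv x hx).hasFDerivAt.fderiv]
    ext
    simp
  -- `h s → 0` as `s → 0⁺`
  have hcont : Continuous h :=
    (continuous_pow 2).mul (continuous_const.inner (hv.continuous.comp (continuous_id.smul continuous_const)))
  have h0 : h 0 = 0 := by simp [hh]
  have hlim : Tendsto h (𝓝[>] (0 : ℝ)) (𝓝 (h 1)) := by
    refine (tendsto_const_nhds (x := h 1)).congr' ?_
    filter_upwards [self_mem_nhdsWithin] with s hs using (hconst s hs).symm
  have hlim0 : Tendsto h (𝓝[>] (0 : ℝ)) (𝓝 0) := by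
    have := (hcont.tendsto 0).mono_left (nhdsWithin_le_nhds (s := Ioi (0 : ℝ)))
    rwa [h0] at this
  have h1 : h 1 = 0 := tendsto_nhds_unique hlim hlim0
  have : ⟪z, v z⟫ = h 1 := by simp [hh]
  rw [this, h1]

/-- ★ A RADIAL DIVERGENCE-FREE `C¹` FIELD ON `ℝ³` VANISHES (centre `0`).  If `v ∈ C¹(ℝ³; ℝ³)` is everywhere parallel to the position
vector (`v z × z = 0`) and divergence free, then `v ≡ 0`. [folklore] -/
theorem eq_zero_of_cross_self_eq_zero_of_isDivFree {v : EuclideanSpace ℝ (Fin 3) → EuclideanSpace ℝ (Fin 3)}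
    (hv : ContDiff ℝ 1 v) (hrad : ∀ z, cross (v z) z = 0) (hdiv : VectorCalculus.IsDivFree v) :
    ∀ z, v z = 0 := by
  have hoff : ∀ z : EuclideanSpace ℝ (Fin 3), z ≠ 0 → v z = 0 := by
    intro z hz
    rw [eq_smul_of_cross_eq_zero hz (hrad z), inner_self_eq_zero_of_cross_self_eq_zero_of_isDivFree hv hrad hdiv z,
      zero_div, zero_smul]
  intro z
  by_cases hz : z = 0
  · -- at the origin by continuity: `v = 0` on the punctured space, which is dense
    have hcl : closure ({0}ᶜ : Set (EuclideanSpace ℝ (Fin 3))) ⊆ {w | v w = 0} :=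
      closure_minimal (fun w hw => hoff w hw) (isClosed_eq hv.continuous continuous_const)
    have hd : closure ({0}ᶜ : Set (EuclideanSpace ℝ (Fin 3))) = univ := by
      rw [closure_compl, interior_singleton, compl_empty]
    have : z ∈ closure ({0}ᶜ : Set (EuclideanSpace ℝ (Fin 3))) := by rw [hd]; exact mem_univ _
    exact hcl this
  · exact hoff z hz

/-- ★ The same about any centre `x₀`: `v ∈ C¹`, `v x × (x − x₀) = 0` for all `x`, `div v ≡ 0` ⇒ `v ≡ 0`. [folklore] -/
theorem eq_zero_of_cross_sub_eq_zero_of_isDivFree {v : EuclideanSpace ℝ (Fin 3) → EuclideanSpace ℝ (Fin 3)}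
    (x₀ : EuclideanSpace ℝ (Fin 3)) (hv : ContDiff ℝ 1 v) (hrad : ∀ x, cross (v x) (x - x₀) = 0)
    (hdiv : VectorCalculus.IsDivFree v) : ∀ x, v x = 0 := by
  set w : EuclideanSpace ℝ (Fin 3) → EuclideanSpace ℝ (Fin 3) := fun z => v (z + x₀) with hw
  have hwc : ContDiff ℝ 1 w := hv.comp (contDiff_id.add contDiff_const)
  have hwrad : ∀ z, cross (w z) z = 0 := fun z => by
    have := hrad (z + x₀)
    rwa [add_sub_cancel_right] at this
  have hwdiv : VectorCalculus.IsDivFree w := fun z => by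
    have h1 : fderiv ℝ w z = fderiv ℝ v (z + x₀) := by
      rw [hw, fderiv_comp_add_right]
    simp only [VectorCalculus.divergence, h1]
    exact hdiv (z + x₀)
  intro x
  have := eq_zero_of_cross_self_eq_zero_of_isDivFree hwc hwrad hwdiv (x - x₀)
  simpa [hw] using this

/-- ★ THE RADIAL BRANCH OF THE RUNG `stub_singleDegreeRung` (antidynamo v2, BC5).  Under the rung's class hypotheses — a bounded ancient
mild solution (duality class, `ν = 1`), jointly smooth on `(−∞,0) × ℝ³` — and the BRANCH CONDITION that every slice is radial about
`x₀` (`v t x × (x − x₀) = 0`; this is what the single-degree representation leaves when the potential `φ` is differentiable on a set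
with empty interior), every slice vanishes, in particular is constant.  Divergence-freeness of the slices comes from the class (weakly
divergence free + `C¹`, tree `IsWeaklyDivFree.isDivFree_of_contDiff`). [folklore] -/
theorem singleDegreeRung_of_radial
    (v : ℝ → EuclideanSpace ℝ (Fin 3) → EuclideanSpace ℝ (Fin 3)) (x₀ : EuclideanSpace ℝ (Fin 3))
    (hB : Literature.Analysis.FluidPDE.IsBoundedAncientMildSolution 1 v)
    (hsm : ContDiffOn ℝ (⊤ : ℕ∞) (Function.uncurry v) (Set.Iio 0 ×ˢ Set.univ))
    (hrad : ∀ t < 0, ∀ x, cross (v t x) (x - x₀) = 0) :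
    ∀ t < 0, ∃ b : EuclideanSpace ℝ (Fin 3), ∀ x, v t x = b := by
  intro t ht
  have hsm' : IsSmoothSpaceTimeOn (Iio 0) v := hsm
  have h1 : ContDiff ℝ 1 (v t) := (hsm'.contDiff_slice ht).of_le (by norm_cast)
  have hdiv : VectorCalculus.IsDivFree (v t) := (hB.isAncientMildSolution.1 t ht).isDivFree_of_contDiff h1
  exact ⟨0, eq_zero_of_cross_sub_eq_zero_of_isDivFree x₀ h1 (hrad t ht) hdiv⟩

end Summit.NavierStokesRegularity.NavierStokesRegularity.Theorems.PoloidalLiouville.Antidynamo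

end
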